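import Summits.AtomisticToContinuum.BoseEinsteinCondensation.Theorems.BECThomsonPrincipleGDTransferSeededPlainInteractionForms

/-!
# Route `BECThomsonPrinciple`, crux `GDTransfer` (stmt-AtomisticToContinuum-9482), line `seeded-continuity`:
# stub `stub_plainInteraction`, part 2 of 4 — pair weights, masses under the slot operators, bookkeeping sums

Support file (part 2 of 4) of the registered stub `stub_plainInteraction` (`PlainInteractionBound`), continuing part 1
(`…SeededPlainInteractionForms`).  Three groups of elementary lemmas:
* **the pair weights** `X ↦ v^per(x_p − x_q)` of a finite continuous finite-range profile: finiteness and continuity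
  (`periodizedPotential_ne_top`, `continuous_pairWeight`), flatness in the slots outside the pair (`pairWeight_update`),
  the real periodic interaction as the sum of the pair weights (`toReal_periodicInteraction`), the pair form read in
  `ℝ≥0∞`, and JENSEN IN A SLOT OF THE PAIR (exact): `∫ v^per(x_p − x_q)|h|² = L⁻³‖v‖₁ · ∫|h|²` for continuous `h` flat
  in a slot `k ∈ {p, q}` (`integral_pairWeight_norm_sq_flat`; `Bare.slotAvg_pairPot`);
* **masses under the slot operators** (real Bochner form): `∫|P_i g|² ≤ ∫|g|²`, `∫|P_i^{(n)} g|² ≤ ∫|g|²`,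
  `|b_i g| = |P_i g|`, `∫|Ψ|² = 1` for a periodic trial state;
* **bookkeeping**: the `(i,j)`-double sum of one pair `A = {p,q}` (rows `i ∉ A` purely imaginary, entries
  `i ∈ A ∌ j` vanishing, `|A|²` bounded local entries: `abs_re_sum_sum_le`), and THE SUM OVER PAIRS
  `|Σ_{p<q} d_pq| ≤ 8σN² + 8N√σ√E` from `|d_pq| ≤ 8σ + 8√σ√e_pq`, `e ≥ 0`, `Σ_{p<q} e_pq ≤ E` (two Cauchy–Schwarz
  steps on finite sums: `abs_sum_pairs_le`; registered helper statement `plainInteraction_abs_sum_pairs_le`).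
All [folklore] (KennedyLiebShastry1988 §2; arXiv:1211.2778 §2; LSSY2005 App. A).
-/

noncomputable section

open MeasureTheory Filter
open scoped ENNReal NNReal ComplexConjugate

namespace Summit.AtomisticToContinuum.BoseEinsteinCondensation.Cruxes.GDTransfer.Seeded

namespace PlainInteraction

open Literature.MathematicalPhysics.QuantumManyBody.BoseGas
open Summit.AtomisticToContinuum.BoseEinsteinCondensation.Theorems.GaussianDominationCan.Negative
open Summit.AtomisticToContinuum.BoseEinsteinCondensation.Cruxes.GDTransfer.DysonDressedWitness
open Lnss Sector

variable {N m : ℕ} {L : ℝ}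

/-! ## The pair weights `v^per(x_p − x_q)` of a finite continuous profile -/

section PairWeight

variable {v : ℝ → ℝ≥0∞}

/-- The periodisation of a finite continuous finite-range profile is finite everywhere (`L ≠ 0`). [folklore] -/
theorem periodizedPotential_ne_top (hv : IsRepulsiveFiniteRange v) (hfc : IsFiniteContinuous v) (hL : L ≠ 0)
    (x : Space) : periodizedPotential v L x ≠ ⊤ := by
  obtain ⟨-, R₀, hR⟩ := hv
  exact Theorems.PositiveMinimiserStub.periodizedPotential_ne_top_of_finiteRange hfc.1 hR hL x

/-- **The real pair weight `X ↦ v^per(x_p − x_q)` is continuous** for a finite continuous finite-range profile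
(locally the periodisation is a finite sum of translates). [folklore] -/
theorem continuous_pairWeight (hv : IsRepulsiveFiniteRange v) (hfc : IsFiniteContinuous v) (hL : L ≠ 0)
    (p q : Fin N) : Continuous fun X : Config N => (periodizedPotential v L (X p - X q)).toReal := by
  obtain ⟨-, R₀, hR⟩ := hv
  exact (Theorems.PositiveMinimiserStub.contDiff_toReal_periodizedPotential_locFinite (k := 0) hfc.1 hR hL
    (contDiff_zero.2 hfc.2)).continuous.comp ((continuous_apply p).sub (continuous_apply q))

/-- The pair weight of the pair `(p, q)` does not depend on a slot `l ∉ {p, q}`. [folklore] -/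
theorem pairWeight_update (v : ℝ → ℝ≥0∞) (L : ℝ) {l p q : Fin N} (hp : p ≠ l) (hq : q ≠ l) (X : Config N)
    (z : Space) :
    (periodizedPotential v L (Function.update X l z p - Function.update X l z q)).toReal =
      (periodizedPotential v L (X p - X q)).toReal := by
  rw [Function.update_of_ne hp, Function.update_of_ne hq]

/-- The real periodic interaction is the sum of the real pair weights (finite profile). [folklore] -/
theorem toReal_periodicInteraction (hv : IsRepulsiveFiniteRange v) (hfc : IsFiniteContinuous v) (hL : L ≠ 0)
    (X : Config N) :
    (periodicInteraction v L X).toReal =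
      ∑ p : Fin N, ∑ q ∈ (Finset.univ : Finset (Fin N)).filter (fun q => p < q),
        (periodizedPotential v L (X p - X q)).toReal := by
  unfold periodicInteraction
  rw [ENNReal.toReal_sum fun p _ => ENNReal.sum_ne_top.2 fun q _ => periodizedPotential_ne_top hv hfc hL _]
  exact Finset.sum_congr rfl fun p _ => ENNReal.toReal_sum fun q _ => periodizedPotential_ne_top hv hfc hL _

/-- The real periodic interaction of a finite continuous finite-range profile is continuous. [folklore] -/
theorem continuous_toReal_periodicInteraction (hv : IsRepulsiveFiniteRange v) (hfc : IsFiniteContinuous v)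
    (hL : L ≠ 0) : Continuous fun X : Config N => (periodicInteraction v L X).toReal := by
  have h : (fun X : Config N => (periodicInteraction v L X).toReal) = fun X =>
      ∑ p : Fin N, ∑ q ∈ (Finset.univ : Finset (Fin N)).filter (fun q => p < q),
        (periodizedPotential v L (X p - X q)).toReal := funext (toReal_periodicInteraction hv hfc hL)
  rw [h]
  exact continuous_finsetSum _ fun p _ => continuous_finsetSum _ fun q _ => continuous_pairWeight hv hfc hL p q

/-- The real pair form read in `ℝ≥0∞`: `ofReal (∫ v^per_{pq}|h|²) = ∫⁻ v^per_{pq} ‖h‖₊²`. [folklore] -/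
theorem ofReal_integral_pairWeight_norm_sq (hv : IsRepulsiveFiniteRange v) (hfc : IsFiniteContinuous v)
    (hL : L ≠ 0) (p q : Fin N) {h : Config N → ℂ} (hh : Continuous h) :
    ENNReal.ofReal (∫ X in cellN N L, (periodizedPotential v L (X p - X q)).toReal * ‖h X‖ ^ 2) =
      ∫⁻ X in cellN N L, periodizedPotential v L (X p - X q) * ((‖h X‖₊ : ℝ≥0∞)) ^ 2 := by
  rw [ofReal_integral_weight_norm_sq (continuous_pairWeight hv hfc hL p q) (fun X => ENNReal.toReal_nonneg) hh]
  exact lintegral_congr fun X => by rw [ENNReal.ofReal_toReal (periodizedPotential_ne_top hv hfc hL _)]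

/-- **Jensen in a slot of the pair (exact)**: for continuous `h` FLAT in a slot `k ∈ {p, q}` (`p ≠ q`),
`∫ v^per(x_p − x_q)|h|² = L⁻³‖v‖₁ · ∫|h|²` (the slot integral unfolds the periodisation, `slotAvg_pairPot`).
[folklore] -/
theorem integral_pairWeight_norm_sq_flat {n' : ℕ} (hL : 0 < L) (hv : IsRepulsiveFiniteRange v)
    (hfc : IsFiniteContinuous v) {k p q : Fin (n' + 1)} (hpq : p ≠ q) (hk : k = p ∨ k = q)
    {h : Config (n' + 1) → ℂ} (hh : Continuous h) (hflat : ∀ X z, h (Function.update X k z) = h X) :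
    ∫ X in cellN (n' + 1) L, (periodizedPotential v L (X p - X q)).toReal * ‖h X‖ ^ 2 =
      ((ENNReal.ofReal (L ^ 3))⁻¹ * ∫⁻ x : Space, v ‖x‖).toReal * ∫ X in cellN (n' + 1) L, ‖h X‖ ^ 2 := by
  have hW := Bare.measurable_pairPot hv.1 L p q (N := n' + 1)
  have hflat' : ∀ (X : Config (n' + 1)) (y : Space),
      ((‖h (Function.update X k y)‖₊ : ℝ≥0∞)) ^ 2 = ((‖h X‖₊ : ℝ≥0∞)) ^ 2 := fun X y => by rw [hflat]
  -- adapted from `Bare.lintegral_pairPot_sq_cellAvg_le` (the flat case)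
  have key : ∫⁻ X in cellN (n' + 1) L, periodizedPotential v L (X p - X q) * ((‖h X‖₊ : ℝ≥0∞)) ^ 2 =
      (ENNReal.ofReal (L ^ 3))⁻¹ * (∫⁻ x : Space, v ‖x‖) * mass L h := by
    calc ∫⁻ X in cellN (n' + 1) L, periodizedPotential v L (X p - X q) * ((‖h X‖₊ : ℝ≥0∞)) ^ 2
        = ∫⁻ X in cellN (n' + 1) L, ((‖h X‖₊ : ℝ≥0∞)) ^ 2 * periodizedPotential v L (X p - X q) :=
          lintegral_congr fun X => mul_comm _ _
      _ = ∫⁻ X in cellN (n' + 1) L, ((‖h X‖₊ : ℝ≥0∞)) ^ 2 *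
            ((ENNReal.ofReal (L ^ 3))⁻¹ * ∫⁻ y in cell L,
              periodizedPotential v L (Function.update X k y p - Function.update X k y q)) :=
          (Bare.lintegral_cellN_mul_slotAvg hL k (Bare.measurable_nnnorm_sq hh.measurable) hW hflat').symm
      _ = ∫⁻ X in cellN (n' + 1) L, ((‖h X‖₊ : ℝ≥0∞)) ^ 2 *
            ((ENNReal.ofReal (L ^ 3))⁻¹ * ∫⁻ x : Space, v ‖x‖) :=
          lintegral_congr fun X => by rw [Bare.slotAvg_pairPot hL hv.1 hpq hk X]
      _ = (ENNReal.ofReal (L ^ 3))⁻¹ * (∫⁻ x : Space, v ‖x‖) * mass L h := by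
          rw [lintegral_mul_const _ (Bare.measurable_nnnorm_sq hh.measurable), mul_comm]; rfl
  have hI0 : 0 ≤ ∫ X in cellN (n' + 1) L, (periodizedPotential v L (X p - X q)).toReal * ‖h X‖ ^ 2 :=
    integral_nonneg fun X => mul_nonneg ENNReal.toReal_nonneg (sq_nonneg _)
  have hm : (mass L h).toReal = ∫ X in cellN (n' + 1) L, ‖h X‖ ^ 2 := by
    unfold mass
    rw [lintegral_nnnorm_sq_eq _ hh, ENNReal.toReal_ofReal (integral_nonneg fun X => sq_nonneg _)]
  rw [← ENNReal.toReal_ofReal hI0, ofReal_integral_pairWeight_norm_sq hv hfc hL.ne' p q hh, key,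
    ENNReal.toReal_mul, hm]

end PairWeight

/-! ## Masses under the slot operators (real form) -/

/-- `∫|P_i g|² ≤ ∫|g|²` (real Bochner form of `Bare.mass_cellAvg_le`). [folklore] -/
theorem integral_norm_sq_cellAvg_le {n' : ℕ} (hL : 0 < L) (i : Fin (n' + 1)) {g : Config (n' + 1) → ℂ}
    (hg : Continuous g) :
    ∫ X in cellN (n' + 1) L, ‖cellAvg (n' + 1) L i g X‖ ^ 2 ≤ ∫ X in cellN (n' + 1) L, ‖g X‖ ^ 2 := by
  have h := Bare.mass_cellAvg_le hL i hg
  unfold mass at h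
  rw [lintegral_nnnorm_sq_eq _ (continuous_cellAvg i hg), lintegral_nnnorm_sq_eq _ hg] at h
  exact (ENNReal.ofReal_le_ofReal_iff (integral_nonneg fun X => sq_nonneg _)).1 h

/-- `∫|P_i^{(n)} g|² ≤ ∫|g|²` (`P_i^{(n)} = P_i ∘ conj(e_n(x_i))` and `|e_n| = 1`). [folklore] -/
theorem integral_norm_sq_fourierAvg_le (hL : 0 < L) (n : Fin 3 → ℤ) (i : Fin (m + 1)) {g : Config (m + 1) → ℂ}
    (hg : Continuous g) :
    ∫ X in cellN (m + 1) L, ‖fourierAvg m L n i g X‖ ^ 2 ≤ ∫ X in cellN (m + 1) L, ‖g X‖ ^ 2 := by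
  have hc : Continuous fun X : Config (m + 1) => conj (cellWave L n (X i)) * g X :=
    ((Complex.continuous_conj.comp (continuous_cellWave L n)).comp (continuous_apply i)).mul hg
  have h := integral_norm_sq_cellAvg_le hL i hc
  rw [cellAvg_conj_cellWave_mul] at h
  refine h.trans_eq (integral_congr_ae (Eventually.of_forall fun X => ?_))
  simp only [norm_mul, Complex.norm_conj, norm_cellWave, one_mul]

/-- `|b_i g| = |P_i g|` pointwise (`|e_n| = 1`). [folklore] -/
theorem norm_up (n : Fin 3 → ℤ) (i : Fin N) (g : Config N → ℂ) (X : Config N) :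
    ‖cellWave L n (X i) * cellAvg N L i g X‖ = ‖cellAvg N L i g X‖ := by
  rw [norm_mul, norm_cellWave, one_mul]

/-- `b_i g` is continuous for continuous `g`. [folklore] -/
theorem continuous_up (n : Fin 3 → ℤ) (i : Fin N) {g : Config N → ℂ} (hg : Continuous g) :
    Continuous fun X => cellWave L n (X i) * cellAvg N L i g X :=
  ((continuous_cellWave L n).comp (continuous_apply i)).mul (continuous_cellAvg i hg)

/-- A periodic trial state has real mass `∫|Ψ|² = 1`. [folklore] -/
theorem integral_norm_sq_trialState (Ψ : PeriodicTrialState (m + 1) L) :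
    ∫ X in cellN (m + 1) L, ‖Ψ.ψ X‖ ^ 2 = 1 := by
  have h := Ψ.norm_eq
  rw [lintegral_nnnorm_sq_eq _ Ψ.contDiff.continuous] at h
  exact ENNReal.ofReal_eq_one.1 h

/-! ## Bookkeeping: the `(i, j)`-double sum pair by pair, and the sum over pairs -/

/-- **Per-pair bookkeeping.**  For the `(i,j)`-indexed terms of one pair `A = {p,q}`: rows `i ∉ A` are purely
imaginary (`t₁ = conj t₄`, `t₂ = conj t₃`), entries `i ∈ A, j ∉ A` vanish (`t₁ = t₃`, `t₂ = t₄`), and the `|A|²`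
local entries are bounded; hence `|Re Σ_{i,j}(t₁ + t₂ − t₃ − t₄)| ≤ |A|²(2σ + 2√σ√e)`. [folklore] -/
theorem abs_re_sum_sum_le {ι : Type*} [Fintype ι] [DecidableEq ι] (A : Finset ι) (t₁ t₂ t₃ t₄ : ι → ι → ℂ)
    {σ e : ℝ}
    (h₁ : ∀ i ∉ A, ∀ j, t₁ i j = conj (t₄ i j) ∧ t₂ i j = conj (t₃ i j))
    (h₂ : ∀ i ∈ A, ∀ j ∉ A, t₁ i j = t₃ i j ∧ t₂ i j = t₄ i j)
    (h₃ : ∀ i ∈ A, ∀ j ∈ A, ‖t₁ i j‖ ≤ σ ∧ ‖t₂ i j‖ ≤ σ ∧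
      ‖t₃ i j‖ ≤ Real.sqrt σ * Real.sqrt e ∧ ‖t₄ i j‖ ≤ Real.sqrt σ * Real.sqrt e) :
    |(∑ i, ∑ j, (t₁ i j + t₂ i j - t₃ i j - t₄ i j)).re| ≤
      (A.card : ℝ) ^ 2 * (2 * σ + 2 * (Real.sqrt σ * Real.sqrt e)) := by
  have hre : (∑ i, ∑ j, (t₁ i j + t₂ i j - t₃ i j - t₄ i j)).re =
      ∑ i ∈ A, ∑ j ∈ A, (t₁ i j + t₂ i j - t₃ i j - t₄ i j).re := by
    calc (∑ i, ∑ j, (t₁ i j + t₂ i j - t₃ i j - t₄ i j)).re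
        = ∑ i, ∑ j, (t₁ i j + t₂ i j - t₃ i j - t₄ i j).re := by
          rw [Complex.re_sum]
          exact Finset.sum_congr rfl fun i _ => Complex.re_sum _ _
      _ = ∑ i ∈ A, ∑ j, (t₁ i j + t₂ i j - t₃ i j - t₄ i j).re := by
          refine (Finset.sum_subset (Finset.subset_univ A) fun i _ hi => Finset.sum_eq_zero fun j _ => ?_).symm
          obtain ⟨e1, e2⟩ := h₁ i hi j
          rw [e1, e2]
          simp only [Complex.add_re, Complex.sub_re, Complex.conj_re]
          ring
      _ = ∑ i ∈ A, ∑ j ∈ A, (t₁ i j + t₂ i j - t₃ i j - t₄ i j).re := by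
          refine Finset.sum_congr rfl fun i hi => (Finset.sum_subset (Finset.subset_univ A) fun j _ hj => ?_).symm
          obtain ⟨e1, e2⟩ := h₂ i hi j hj
          rw [e1, e2]
          simp only [Complex.add_re, Complex.sub_re]
          ring
  rw [hre]
  calc |∑ i ∈ A, ∑ j ∈ A, (t₁ i j + t₂ i j - t₃ i j - t₄ i j).re|
      ≤ ∑ i ∈ A, |∑ j ∈ A, (t₁ i j + t₂ i j - t₃ i j - t₄ i j).re| := Finset.abs_sum_le_sum_abs _ _
    _ ≤ ∑ i ∈ A, ∑ j ∈ A, |(t₁ i j + t₂ i j - t₃ i j - t₄ i j).re| :=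
        Finset.sum_le_sum fun i _ => Finset.abs_sum_le_sum_abs _ _
    _ ≤ ∑ i ∈ A, ∑ j ∈ A, (2 * σ + 2 * (Real.sqrt σ * Real.sqrt e)) := by
        refine Finset.sum_le_sum fun i hi => Finset.sum_le_sum fun j hj => ?_
        obtain ⟨b1, b2, b3, b4⟩ := h₃ i hi j hj
        calc |(t₁ i j + t₂ i j - t₃ i j - t₄ i j).re| ≤ ‖t₁ i j + t₂ i j - t₃ i j - t₄ i j‖ :=
              Complex.abs_re_le_norm _
          _ ≤ ‖t₁ i j‖ + ‖t₂ i j‖ + ‖t₃ i j‖ + ‖t₄ i j‖ := by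
              have ha := norm_sub_le (t₁ i j + t₂ i j - t₃ i j) (t₄ i j)
              have hb := norm_sub_le (t₁ i j + t₂ i j) (t₃ i j)
              have hc := norm_add_le (t₁ i j) (t₂ i j)
              linarith
          _ ≤ 2 * σ + 2 * (Real.sqrt σ * Real.sqrt e) := by linarith
    _ = (A.card : ℝ) ^ 2 * (2 * σ + 2 * (Real.sqrt σ * Real.sqrt e)) := by
        rw [Finset.sum_const, Finset.sum_const, nsmul_eq_mul, nsmul_eq_mul]
        ring

/-- Cauchy–Schwarz for square roots on a finite set: `Σ_k √a_k ≤ √(|s| · Σ_k a_k)` for `a ≥ 0`. [folklore] -/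
theorem sum_sqrt_le_sqrt_card_mul_sum {ι : Type*} (s : Finset ι) {a : ι → ℝ} (ha : ∀ k ∈ s, 0 ≤ a k) :
    ∑ k ∈ s, Real.sqrt (a k) ≤ Real.sqrt (s.card * ∑ k ∈ s, a k) := by
  refine (Real.le_sqrt (Finset.sum_nonneg fun k _ => Real.sqrt_nonneg _)
    (mul_nonneg (Nat.cast_nonneg _) (Finset.sum_nonneg ha))).2 ?_
  calc (∑ k ∈ s, Real.sqrt (a k)) ^ 2 ≤ s.card * ∑ k ∈ s, Real.sqrt (a k) ^ 2 := sq_sum_le_card_mul_sum_sq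
    _ = s.card * ∑ k ∈ s, a k := by
        rw [Finset.sum_congr rfl fun k hk => Real.sq_sqrt (ha k hk)]

/-- **The sum over pairs.**  If `|d_{pq}| ≤ 8σ + 8√σ√e_{pq}` for `p < q`, `e ≥ 0` and `Σ_{p<q} e_{pq} ≤ E`, then
`|Σ_{p<q} d_{pq}| ≤ 8σN² + 8N√σ√E` (two Cauchy–Schwarz steps on the finite sums). [folklore] -/
theorem abs_sum_pairs_le {N : ℕ} {σ E : ℝ} (hσ : 0 ≤ σ) (d e : Fin N → Fin N → ℝ)
    (he : ∀ p q, 0 ≤ e p q)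
    (hd : ∀ p q, p < q → |d p q| ≤ 8 * σ + 8 * (Real.sqrt σ * Real.sqrt (e p q)))
    (hsum : ∑ p : Fin N, ∑ q ∈ (Finset.univ : Finset (Fin N)).filter (fun q => p < q), e p q ≤ E) :
    |∑ p : Fin N, ∑ q ∈ (Finset.univ : Finset (Fin N)).filter (fun q => p < q), d p q| ≤
      8 * σ * (N : ℝ) ^ 2 + 8 * N * (Real.sqrt σ * Real.sqrt E) := by
  set S : Fin N → Finset (Fin N) := fun p => (Finset.univ : Finset (Fin N)).filter (fun q => p < q) with hS
  have hScard : ∀ p, ((S p).card : ℝ) ≤ N := fun p => by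
    have h := (S p).card_le_univ
    rw [Fintype.card_fin] at h
    exact_mod_cast h
  have hEp : ∀ p, 0 ≤ ∑ q ∈ S p, e p q := fun p => Finset.sum_nonneg fun q _ => he p q
  -- per row: `Σ_{q ∈ S_p} √e_{pq} ≤ √(N E_p)`
  have hrow : ∀ p, ∑ q ∈ S p, Real.sqrt (e p q) ≤ Real.sqrt N * Real.sqrt (∑ q ∈ S p, e p q) := fun p => by
    calc ∑ q ∈ S p, Real.sqrt (e p q) ≤ Real.sqrt ((S p).card * ∑ q ∈ S p, e p q) :=
          sum_sqrt_le_sqrt_card_mul_sum (S p) fun q _ => he p q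
      _ ≤ Real.sqrt (N * ∑ q ∈ S p, e p q) :=
          Real.sqrt_le_sqrt (mul_le_mul_of_nonneg_right (hScard p) (hEp p))
      _ = Real.sqrt N * Real.sqrt (∑ q ∈ S p, e p q) := Real.sqrt_mul (Nat.cast_nonneg _) _
  -- the rows together: `Σ_p √E_p ≤ √(N Σ_p E_p) ≤ √(N E)`
  have hrows : ∑ p : Fin N, Real.sqrt (∑ q ∈ S p, e p q) ≤ Real.sqrt N * Real.sqrt E := by
    calc ∑ p : Fin N, Real.sqrt (∑ q ∈ S p, e p q)
        ≤ Real.sqrt ((Finset.univ : Finset (Fin N)).card * ∑ p : Fin N, ∑ q ∈ S p, e p q) :=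
          sum_sqrt_le_sqrt_card_mul_sum _ fun p _ => hEp p
      _ ≤ Real.sqrt (N * E) := by
          rw [Finset.card_univ, Fintype.card_fin]
          exact Real.sqrt_le_sqrt (mul_le_mul_of_nonneg_left hsum (Nat.cast_nonneg _))
      _ = Real.sqrt N * Real.sqrt E := Real.sqrt_mul (Nat.cast_nonneg _) _
  have hσ0 : 0 ≤ Real.sqrt σ := Real.sqrt_nonneg _
  calc |∑ p : Fin N, ∑ q ∈ S p, d p q|
      ≤ ∑ p : Fin N, |∑ q ∈ S p, d p q| := Finset.abs_sum_le_sum_abs _ _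
    _ ≤ ∑ p : Fin N, ∑ q ∈ S p, |d p q| := Finset.sum_le_sum fun p _ => Finset.abs_sum_le_sum_abs _ _
    _ ≤ ∑ p : Fin N, ∑ q ∈ S p, (8 * σ + 8 * (Real.sqrt σ * Real.sqrt (e p q))) :=
        Finset.sum_le_sum fun p _ => Finset.sum_le_sum fun q hq => hd p q (Finset.mem_filter.1 hq).2
    _ = ∑ p : Fin N, (8 * σ * (S p).card + 8 * Real.sqrt σ * ∑ q ∈ S p, Real.sqrt (e p q)) := by
        refine Finset.sum_congr rfl fun p _ => ?_
        rw [Finset.sum_add_distrib, Finset.sum_const, nsmul_eq_mul, Finset.mul_sum]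
        congr 1
        · ring
        · exact Finset.sum_congr rfl fun q _ => by ring
    _ ≤ ∑ p : Fin N, (8 * σ * N + 8 * Real.sqrt σ * (Real.sqrt N * Real.sqrt (∑ q ∈ S p, e p q))) := by
        refine Finset.sum_le_sum fun p _ => add_le_add ?_ ?_
        · exact mul_le_mul_of_nonneg_left (hScard p) (by positivity)
        · exact mul_le_mul_of_nonneg_left (hrow p) (by positivity)
    _ = 8 * σ * (N : ℝ) ^ 2 + 8 * Real.sqrt σ * Real.sqrt N * ∑ p : Fin N, Real.sqrt (∑ q ∈ S p, e p q) := by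
        rw [Finset.sum_add_distrib, Finset.sum_const, Finset.card_univ, Fintype.card_fin, nsmul_eq_mul,
          ← Finset.mul_sum, ← Finset.mul_sum]
        ring
    _ ≤ 8 * σ * (N : ℝ) ^ 2 + 8 * Real.sqrt σ * Real.sqrt N * (Real.sqrt N * Real.sqrt E) := by
        gcongr
    _ = 8 * σ * (N : ℝ) ^ 2 + 8 * N * (Real.sqrt σ * Real.sqrt E) := by
        rw [mul_assoc (8 * Real.sqrt σ) (Real.sqrt N), ← mul_assoc (Real.sqrt N),
          Real.mul_self_sqrt (Nat.cast_nonneg _)]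
        ring

end PlainInteraction

/-- **Part 2 of `stub_plainInteraction` (registered helper statement)**: the sum over pairs — if
`|d_pq| ≤ 8σ + 8√σ√e_pq` for `p < q`, `e ≥ 0` and `Σ_{p<q} e_pq ≤ E` (`σ ≥ 0`), then `|Σ_{p<q} d_pq| ≤ 8σN² + 8N√σ√E`
(two Cauchy–Schwarz steps on the finite sums). [folklore] (KennedyLiebShastry1988 §2; arXiv:1211.2778 §2; LSSY2005 App. A) -/
theorem plainInteraction_abs_sum_pairs_le :
    ∀ (N : ℕ) (σ E : ℝ), 0 ≤ σ → ∀ (d e : Fin N → Fin N → ℝ), (∀ p q, 0 ≤ e p q) →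
      (∀ p q, p < q → |d p q| ≤ 8 * σ + 8 * (Real.sqrt σ * Real.sqrt (e p q))) →
      ∑ p : Fin N, ∑ q ∈ (Finset.univ : Finset (Fin N)).filter (fun q => p < q), e p q ≤ E →
        |∑ p : Fin N, ∑ q ∈ (Finset.univ : Finset (Fin N)).filter (fun q => p < q), d p q| ≤
          8 * σ * (N : ℝ) ^ 2 + 8 * N * (Real.sqrt σ * Real.sqrt E) :=
  fun _ _ _ hσ d e he hd hsum => PlainInteraction.abs_sum_pairs_le hσ d e he hd hsum

end Summit.AtomisticToContinuum.BoseEinsteinCondensation.Cruxes.GDTransfer.Seeded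

end
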